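import Summits.QuantumFields.YangMills.Theorems.RandomisedStokesHistoryTailOfChaos

/-!
# Crux `UnitScaleTilt.HistoryTailL` (stmt-QuantumFields-19936), skeleton `Lines/randomised_stokes.lean` (LINE 18, route `RandomisedStokes`):
# the REGISTERED STUB `stub_glue : RectangleTailL → ChaosSuppressedDominationL → ThinDeepWindowTailL → CruxGoal` — BY NAME AND SIGNATURE

Registry bookkeeping only: the glue item stmt-QuantumFields-23887 `RandomisedStokes.HistoryTailOfChaosL` is CLOSED·proved by
`RandomisedStokesHistoryTailOfChaos.randomisedStokes_historyTailOfChaosL_proof` (p686076); this file restates the skeleton's four statements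
verbatim (`abbrev`s with byte-identical bodies, so each is `rfl`-equal to the route decl) and lands the registered stub under its verbatim header,
so that the 19936 registry shows only the two XL stubs (`stub_chaosPackage`, `stub_rectMoments`) open.  No crux, rung or summit is proved;
the Yang–Mills mass gap is NOT proved by any of this.  Cell `ym-idea-1`, LEAD seat `ym-line-sfw-p2` g71 (free hands), `--supports stmt-QuantumFields-19936`.
[folklore]
-/

set_option autoImplicit false

noncomputable section

namespace Summit.QuantumFields.YangMills.Theorems.RandomisedStokesStubGlue

open scoped BigOperators Topology Classical MeasureTheory ProbabilityTheory Matrix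
open MeasureTheory

/-- Registered statement `RectangleTailL` of the skeleton (= the route decl of the same name, byte-identical body), verbatim; NOT proved here. -/
abbrev RectangleTailL : Prop :=
  open Literature.MathematicalPhysics.QuantumFieldTheory.Balaban1983to89 Literature.MathematicalPhysics.QuantumFieldTheory.Balaban1983to89.T3ContinuumYM3Torus in ∀ (L : ℕ), ∃ (α c C : ℝ) (A : ℕ), 0 < α ∧ 0 < c ∧ 0 ≤ C ∧ ∀ (F : T3Family) (γ : ℝ), F.L = L → 0 < γ → γ ≤ 1 → ∀ (K a b : ℕ) (x : Site (F.P K) 0) (μ ν : Fin (F.P K).d) (t : ℝ), μ ≠ ν → 1 ≤ a → 1 ≤ b → 2 * (a + b) < (F.P K).sitesPerDir 0 → 0 < t → t ≤ 1 → (T3UnitScaleTilt.gibbsK F T3UnitLawDensityEML.ℰp γ K).real {U | t ≤ GaugeGroup.dist1 (Missing.pathHol U (Missing.rectLoop x μ ν a b))} ≤ C * (F.scheme T3UnitLawDensityEML.ℰp γ).β K ^ A * ((a : ℝ) + b) ^ A * Real.exp (-((c * (t ^ 2 * (F.scheme T3UnitLawDensityEML.ℰp γ).β K / (((a : ℝ)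 + b) * (1 + Real.log ((a : ℝ) + b))))) ^ α))

/-- Registered statement `ChaosSuppressedDominationL` of the skeleton (= the route decl of the same name, byte-identical body), verbatim; NOT proved here. -/
abbrev ChaosSuppressedDominationL : Prop :=
  open Literature.MathematicalPhysics.QuantumFieldTheory.Balaban1983to89 Literature.MathematicalPhysics.QuantumFieldTheory.Balaban1983to89.T3ContinuumYM3Torus in ∀ (L : ℕ), ∃ (D R α c C : ℝ) (A : ℕ), 1 ≤ D ∧ 2 ≤ R ∧ 0 < α ∧ 0 < c ∧ 0 ≤ C ∧ ∀ (F : T3Family) (γ : ℝ), F.L = L → 0 < γ → γ ≤ 1 → ∀ (K j : ℕ) (q : Plaq (F.P K) j) (η : ℝ), j ≤ K → 0 < η → η ≤ 1 → (T3UnitScaleTilt.gibbsK F T3UnitLawDensityEML.ℰp γ K).real {U | (∀ (i a b : ℕ) (x : Site (F.P K) 0) (μ ν : Fin (F.P K).d), μ ≠ ν → i ≤ j → 1 ≤ a → 1 ≤ b → 2 * (a + b) < (F.P K).sitesPerDir 0 → ((a : ℝ) + b) ≤ R * (L : ℝ) ^ i → GaugeGroup.dist1 (Missing.pathHol U (Missing.rectLoop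 x μ ν a b)) ≤ η * Real.sqrt ((L : ℝ) ^ i / (L : ℝ) ^ j)) ∧ D * ((j : ℝ) + 1) * η < GaugeGroup.dist1 (GaugeField.plaqHol (Averaging.iter (fun i => BlockAveraging.blockAvg (P := F.P K) (j := i) T3UnitLawDensityEML.ℰp) j U) q)} ≤ C * (F.scheme T3UnitLawDensityEML.ℰp γ).β K ^ A * Real.exp (-((c * (η / (γ * ((L : ℝ)⁻¹) ^ (K - j)))) ^ α))

/-- Registered statement `ThinDeepWindowTailL` of the skeleton (= the route decl of the same name, byte-identical body), verbatim; NOT proved here. -/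
abbrev ThinDeepWindowTailL : Prop :=
  open Literature.MathematicalPhysics.QuantumFieldTheory.Balaban1983to89 Literature.MathematicalPhysics.QuantumFieldTheory.Balaban1983to89.T3ContinuumYM3Torus in ∀ (L N : ℕ), 0 < N → ∀ (b₀ p₀ b₂ : ℝ), 0 < b₀ → 2 < p₀ → (N : ℝ) ≤ p₀ → b₀ ≤ b₂ → ∃ (γ₁ C c : ℝ) (N' : ℕ), 0 < γ₁ ∧ γ₁ ≤ 1 ∧ 0 < c ∧ ∀ (F : T3Family) (γ : ℝ), F.L = L → 0 < γ → γ ≤ γ₁ → ∀ (K j : ℕ), 1 ≤ j → j ≤ K → ((j : ℝ) + 1) ^ N > B10.pFun b₀ p₀ (Real.sqrt (γ * ((F.L : ℝ)⁻¹) ^ (K - j))) → ∀ p : Plaq (F.P K) j, (T3UnitScaleTilt.gibbsK F T3UnitLawDensityEML.ℰp γ K).real {U | (∀ k, k < j → PlaqSmall (T3UnitScaleTilt.θBal F.L γ b₀ p₀ (K - k)) (Averaging.iter (fun i => BlockAveraging.blockAvg (P := F.P K) (j := i) T3UnitLawDensityEML.ℰp) k U)) ∧ PlaqSmall (T3UnitScaleTilt.θBal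 F.L γ b₂ p₀ (K - j)) (Averaging.iter (fun i => BlockAveraging.blockAvg (P := F.P K) (j := i) T3UnitLawDensityEML.ℰp) j U) ∧ T3UnitScaleTilt.θBal F.L γ b₀ p₀ (K - j) ≤ GaugeGroup.dist1 (GaugeField.plaqHol (Averaging.iter (fun i => BlockAveraging.blockAvg (P := F.P K) (j := i) T3UnitLawDensityEML.ℰp) j U) p)} ≤ C * ((γ * ((F.L : ℝ)⁻¹) ^ (K - j))⁻¹) ^ N' * Real.exp (-(c * B10.pFun b₀ p₀ (Real.sqrt (γ * ((F.L : ℝ)⁻¹) ^ (K - j))) ^ 2))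

/-- The target crux under the skeleton's local name. -/
abbrev CruxGoal : Prop :=
  Summit.QuantumFields.YangMills.Theses.UnitScaleTilt.HistoryTailL

/-- **Registered stub `stub_glue` of skeleton `randomised_stokes.lean` on crux stmt-QuantumFields-19936, BY NAME AND SIGNATURE** — it is the
landed glue item stmt-QuantumFields-23887 (`randomisedStokes_historyTailOfChaosL_proof`, p686076).  Bookkeeping; the three hypotheses are OPEN cruxes;
nothing about the mass gap. [folklore] -/
theorem stub_glue : RectangleTailL → ChaosSuppressedDominationL → ThinDeepWindowTailL → CruxGoal :=
  fun hR hX hT => RandomisedStokesHistoryTailOfChaos.randomisedStokes_historyTailOfChaosL_proof hR hX hT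

end Summit.QuantumFields.YangMills.Theorems.RandomisedStokesStubGlue

end
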